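import Mathlib
import Literature.AlgebraicGeometry.Resolution.QuadraticTransformAlongPrime
import Literature.AlgebraicGeometry.Resolution.AffineBlowupAlgebra
import Literature.AlgebraicGeometry.Resolution.BlowupChartRsop
import Literature.AlgebraicGeometry.Resolution.QuadraticTransforms
import HarnessLib

/-!
# Quadratic transforms of a reduced local ring, branch by branch (I): the branch maps

Topic: `Literature/AlgebraicGeometry/Resolution`. Ring-level structure of one step of Krull's
blow-up tower of a one-dimensional REDUCED local ring (Kollár 2007, Alg. 1.100 / Thm. 1.101;
Krull 1930): let `(R, 𝔪)` be a reduced Noetherian local ring, `𝔪 = (c₁, …, c_n)`, `B` the chart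
ring `(R[𝔪t])_{(c_i t)}` of `Bl_𝔪(Spec R)` (`BlowupChartRsop.lean`, `AffineBlowup.lean`) and
`S = B_𝔴` the local ring at a prime `𝔴` over `𝔪` (a local quadratic transform of `R`;
`BlowupStalkCharts.lean` identifies these with the local rings of an arbitrary blowing up over a
point with `J_x = 𝔪_x`). For every minimal prime `q` of `R` with `c_i ∉ q` the field-valued point
`θ_q : R → R/q → K_q = Frac(R/q)` (`branchPoint`) induces `θ_{q,1} : B → K_q` (`chartBranchMap`
= `chartToField`, `QuadraticTransformAlongPrime.lean`: the chart of the strict transform of the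
branch `V(q)`). This file:

* `chart_eq_zero_of_forall_chartToField` — **`B` embeds into `∏_q K_q`** (reducedness of `R`:
  if `θ_{q,1}(b) = 0` for all such `q` then `b = 0`);
* `branchMap` — the branches PASSING through `𝔴` (`ker θ_{q,1} ⊆ 𝔴`) and their
  maps `ψ_q : S → K_q`, `b/s ↦ θ_{q,1}(b)/θ_{q,1}(s)`, with the computation rules;
* `quotientEquivRangeBranchPoint`, `isLocalRingOf_range_branchPoint` — the branch local ring
  `θ_q(R) ≅ R/q`, a local ring of `K_q`.

Sequel: `ReducedQuadraticTransformBranches.lean` (minimal primes of `S`, the branches of `S` as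
quadratic transforms of the branches of `R`, separation of branches). All PROVED.

## Sources

* J. Kollár, *Lectures on Resolution of Singularities*, Ann. of Math. Stud. 166 (2007), §1.4,
  Alg. 1.100, Thm. 1.101. [Kollar2007]
* M. Herrmann, S. Ikeda, U. Orbanz, *Equimultiplicity and Blowing up* (1988), Ch. II (strict
  transforms under blowing up) and proof of Thm. (30.2). [HerrmannIkedaOrbanz1988]
-/

noncomputable section

open IsLocalRing

namespace Literature.AlgebraicGeometry.Resolution

universe u

variable {R : Type u} [CommRing R] {n : ℕ} (c : Fin n → R) (i : Fin n)

-- the chart ring `chartRing c i = (R[𝔪t])_{(c_i t)}` and its base map `chartBase c i`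
-- (`BlowupChartRsop.lean`; the raw `HomogeneousLocalization.Away …` of `QuadraticTransformAlongPrime.lean`)
local notation3 "𝓑" => chartRing c i
local notation3 "φ" => chartBase c i

/-! ## The field-valued point of a branch -/

section Point

variable (q : Ideal R) [q.IsPrime]

/-- The field-valued point `θ_q : R → R/q → Frac(R/q)` of the branch `V(q)`. [cite: Kollar2007, §1.4] -/
abbrev branchPoint : R →+* FractionRing (R ⧸ q) :=
  (algebraMap (R ⧸ q) (FractionRing (R ⧸ q))).comp (Ideal.Quotient.mk q)

omit [q.IsPrime] in
/-- `θ_q(r) = 0 ↔ r ∈ q`. [cite: Kollar2007, §1.4] -/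
theorem branchPoint_eq_zero_iff (r : R) : branchPoint q r = 0 ↔ r ∈ q := by
  rw [RingHom.comp_apply, IsFractionRing.to_map_eq_zero_iff, Ideal.Quotient.eq_zero_iff_mem]

omit [q.IsPrime] in
/-- `θ_q(r) ≠ 0 ↔ r ∉ q`. [cite: Kollar2007, §1.4] -/
theorem branchPoint_ne_zero_iff (r : R) : branchPoint q r ≠ 0 ↔ r ∉ q :=
  (branchPoint_eq_zero_iff q r).not

omit [q.IsPrime] in
/-- `ker θ_q = q`. [cite: Kollar2007, §1.4] -/
theorem ker_branchPoint : RingHom.ker (branchPoint q) = q := by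
  ext r; rw [RingHom.mem_ker, branchPoint_eq_zero_iff]

/-- Every element of `Frac(R/q)` is a quotient `θ_q(a)/θ_q(b)` with `b ∉ q`. [cite: Kollar2007, §1.4] -/
theorem exists_eq_branchPoint_div (z : FractionRing (R ⧸ q)) :
    ∃ a b : R, b ∉ q ∧ z = branchPoint q a / branchPoint q b := by
  obtain ⟨a, b, hb, rfl⟩ := IsFractionRing.div_surjective (A := R ⧸ q) z
  obtain ⟨a, rfl⟩ := Ideal.Quotient.mk_surjective a
  obtain ⟨b, rfl⟩ := Ideal.Quotient.mk_surjective b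
  refine ⟨a, b, fun hbq => ?_, rfl⟩
  have : (Ideal.Quotient.mk q b) = 0 := Ideal.Quotient.eq_zero_iff_mem.mpr hbq
  exact nonZeroDivisors.ne_zero hb this

end Point

/-! ## The chart embeds into the product of the branch fields -/

section Chart

/-- `θ_{q,1}(b) = 0` iff, writing `φ(c_i)^k b = φ(r)`, `r ∈ q`. [cite: Kollar2007, §1.4] -/
theorem chartToField_branchPoint_eq_zero_iff (q : Ideal R) [q.IsPrime] (hq : c i ∉ q)
    {b : 𝓑} {k : ℕ} {r : R} (h : φ (c i) ^ k * b = φ r) :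
    chartToField c i (branchPoint q) ((branchPoint_ne_zero_iff q _).mpr hq) b = 0 ↔ r ∈ q := by
  have key := chartToField_ne_zero_iff c i (branchPoint q) ((branchPoint_ne_zero_iff q _).mpr hq) h
  have key' := branchPoint_ne_zero_iff q r
  constructor
  · intro h0
    by_contra hr
    exact (key.mpr (key'.mpr hr)) h0
  · intro hr
    by_contra h0
    exact (key'.mp (key.mp h0)) hr

variable [IsReduced R]

/-- **The chart ring of a reduced ring embeds into the product of the branch fields**: if
`θ_{q,1}(b) = 0` for every minimal prime `q ∌ c_i` then `b = 0`. (Write `φ(c_i)^k b = φ(r)`;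
then `c_i r` lies in every minimal prime, hence is `0`, and `φ(c_i)` is a non-zero-divisor.)
[cite: Kollar2007, §1.4] -/
theorem chart_eq_zero_of_forall_chartToField (b : 𝓑)
    (hb : ∀ (q : Ideal R) [q.IsPrime], q ∈ minimalPrimes R → ∀ hci : c i ∉ q,
      chartToField c i (branchPoint q) ((branchPoint_ne_zero_iff q _).mpr hci) b = 0) :
    b = 0 := by
  obtain ⟨k, r, h⟩ := exists_pow_mul_eq_reesChartBase c i b
  -- `c_i * r` lies in every minimal prime
  have hmem : ∀ q ∈ minimalPrimes R, c i * r ∈ q := by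
    intro q hq
    haveI := hq.1.1
    by_cases hci : c i ∈ q
    · exact Ideal.mul_mem_right _ _ hci
    · exact Ideal.mul_mem_left _ _
        ((chartToField_branchPoint_eq_zero_iff c i q hci h).mp (hb q hq hci))
  have hzero : c i * r = 0 := by
    refine IsReduced.eq_zero _ (nilpotent_iff_mem_prime.mpr fun J hJ => ?_)
    obtain ⟨q, hq, hqJ⟩ := Ideal.exists_minimalPrimes_le (I := (⊥ : Ideal R)) (J := J) bot_le
    exact hqJ (hmem q hq)
  -- read the relation in `R[1/c_i]`, where `c_i` is a unit
  have hmem := Ideal.mem_span_range_self (f := c) (x := i)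
  apply reesChart_injective (c i) hmem
  have hu : IsUnit (algebraMap R (Localization.Away (c i)) (c i)) :=
    IsLocalization.Away.algebraMap_isUnit (c i)
  have h' := congrArg (reesChart (c i) hmem) h
  rw [RingHom.map_mul, RingHom.map_pow, reesChart_reesChartBase, reesChart_reesChartBase] at h'
  have hr0 : algebraMap R (Localization.Away (c i)) r = 0 := by
    have h1 : algebraMap R (Localization.Away (c i)) (c i * r) = 0 := by rw [hzero, map_zero]
    rw [map_mul] at h1
    exact (hu.mul_right_eq_zero).mp h1
  rw [hr0] at h'
  rw [map_zero]
  exact ((hu.pow k).mul_right_eq_zero).mp h'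

end Chart

/-! ## The local ring `S = B_𝔴` and its branches -/

section Local

variable (q : Ideal R) [q.IsPrime] (hq : c i ∉ q)

/-- The chart map of the branch `V(q)`: `θ_{q,1} : B → Frac(R/q)` (`chartToField` at the
field-valued point `θ_q`). [cite: HerrmannIkedaOrbanz1988, Thm. (30.2) (proof)] -/
abbrev chartBranchMap : 𝓑 →+* FractionRing (R ⧸ q) :=
  chartToField c i (branchPoint q) ((branchPoint_ne_zero_iff q _).mpr hq)

variable (𝔴 : Ideal (chartRing c i)) [𝔴.IsPrime] (S : Type u) [CommRing S]
  [Algebra (chartRing c i) S] [IsLocalization.AtPrime S 𝔴]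

variable {c i q hq 𝔴}

/-- The branch `V(q)` PASSES through the point `𝔴` of the chart when its strict transform
`ker θ_{q,1}` is contained in `𝔴`; then `θ_{q,1}` takes nonzero values off `𝔴`.
[cite: Kollar2007, §1.4] -/
theorem isUnit_chartBranchMap_of_ker_le (hpass : RingHom.ker (chartBranchMap c i q hq) ≤ 𝔴)
    (s : 𝔴.primeCompl) : IsUnit (chartBranchMap c i q hq s) :=
  isUnit_iff_ne_zero.mpr fun h0 => s.2 (hpass ((RingHom.mem_ker).mpr h0))

variable (c i q hq 𝔴)

/-- **The branch map `ψ_q : S = B_𝔴 → Frac(R/q)`** of a branch through `𝔴`, `b/s ↦ θ_{q,1}(b)/θ_{q,1}(s)`;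
its image is the local ring of the strict transform of `V(q)` at the point, its kernel the
minimal prime of `S` on that branch. [cite: Kollar2007, §1.4] -/
def branchMap (hpass : RingHom.ker (chartBranchMap c i q hq) ≤ 𝔴) : S →+* FractionRing (R ⧸ q) :=
  IsLocalization.lift (M := 𝔴.primeCompl) (g := chartBranchMap c i q hq)
    (isUnit_chartBranchMap_of_ker_le hpass)

variable {c i q hq 𝔴}

/-- `ψ_q ∘ (B → S) = θ_{q,1}`. [cite: Kollar2007, §1.4] -/
@[simp] theorem branchMap_algebraMap (hpass : RingHom.ker (chartBranchMap c i q hq) ≤ 𝔴) (b : 𝓑) :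
    branchMap c i q hq 𝔴 S hpass ((algebraMap (chartRing c i) S : chartRing c i →+* S) b) =
      chartBranchMap c i q hq b :=
  IsLocalization.lift_eq _ b

/-- `ψ_q ∘ (R → S) = θ_q`. [cite: Kollar2007, §1.4] -/
theorem branchMap_algebraMap_reesChartBase (hpass : RingHom.ker (chartBranchMap c i q hq) ≤ 𝔴) (r : R) :
    branchMap c i q hq 𝔴 S hpass ((algebraMap (chartRing c i) S : chartRing c i →+* S) (φ r)) =
      branchPoint q r := by
  rw [branchMap_algebraMap, chartToField_reesChartBase]

/-- `ψ_q(b/s) = θ_{q,1}(b)/θ_{q,1}(s)`. [cite: Kollar2007, §1.4] -/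
theorem branchMap_mk' (hpass : RingHom.ker (chartBranchMap c i q hq) ≤ 𝔴) (b : 𝓑) (s : 𝔴.primeCompl) :
    branchMap c i q hq 𝔴 S hpass (IsLocalization.mk' S b s) =
      chartBranchMap c i q hq b / chartBranchMap c i q hq s := by
  have hs0 : chartBranchMap c i q hq s ≠ 0 := (isUnit_chartBranchMap_of_ker_le hpass s).ne_zero
  rw [eq_div_iff hs0, ← branchMap_algebraMap S hpass (s : 𝓑), ← map_mul,
    IsLocalization.mk'_spec, branchMap_algebraMap]

/-- `ψ_q(x) = 0` iff `θ_{q,1}` kills a numerator of `x`. [cite: Kollar2007, §1.4] -/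
theorem branchMap_mk'_eq_zero_iff (hpass : RingHom.ker (chartBranchMap c i q hq) ≤ 𝔴) (b : 𝓑) (s : 𝔴.primeCompl) :
    branchMap c i q hq 𝔴 S hpass (IsLocalization.mk' S b s) = 0 ↔ chartBranchMap c i q hq b = 0 := by
  rw [branchMap_mk', div_eq_zero_iff, or_iff_left (isUnit_chartBranchMap_of_ker_le hpass s).ne_zero]

end Local

/-! ## The branch local ring `θ_q(R) ≅ R/q` inside `Frac(R/q)` -/

section BranchRing

variable (q : Ideal R) [q.IsPrime]

/-- `R/q ≅ θ_q(R)`. [cite: Kollar2007, §1.4] -/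
def quotientEquivRangeBranchPoint : R ⧸ q ≃+* (branchPoint q).range :=
  (Ideal.quotEquivOfEq (ker_branchPoint q)).symm.trans (RingHom.quotientKerEquivRange _)

/-- `θ_q(R)` is a local ring when `R` is. [cite: Kollar2007, §1.4] -/
theorem isLocalRing_range_branchPoint [IsLocalRing R] : IsLocalRing (branchPoint q).range :=
  IsLocalRing.of_surjective' (branchPoint q).rangeRestrict (branchPoint q).rangeRestrict_surjective

/-- `θ_q(R)` is a local ring of `Frac(R/q)` (local, with that fraction field). [cite: Kollar2007, §1.4] -/
theorem isLocalRingOf_range_branchPoint [IsLocalRing R] : IsLocalRingOf (branchPoint q).range := by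
  refine ⟨isLocalRing_range_branchPoint q, fun z => ?_⟩
  obtain ⟨a, b, hb, rfl⟩ := exists_eq_branchPoint_div q z
  exact ⟨branchPoint q a, ⟨a, rfl⟩, branchPoint q b, ⟨b, rfl⟩,
    (branchPoint_ne_zero_iff q b).mpr hb, rfl⟩

/-- For `r ∈ 𝔪_R`, `θ_q(r)` is a non-unit of `θ_q(R)` (`q ⊆ 𝔪_R`). [cite: Kollar2007, §1.4] -/
theorem not_isUnit_rangeRestrict_branchPoint [IsLocalRing R] {r : R} (hr : r ∈ maximalIdeal R) :
    ¬ IsUnit ((branchPoint q).rangeRestrict r) := by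
  rintro ⟨u, hu⟩
  obtain ⟨y, hy⟩ := (branchPoint q).rangeRestrict_surjective (↑u⁻¹ : (branchPoint q).range)
  have h1 : (branchPoint q).rangeRestrict (r * y) = 1 := by
    rw [map_mul, ← hu, hy, Units.mul_inv]
  have h2 : branchPoint q (r * y - 1) = 0 := by
    have := congrArg Subtype.val h1
    rw [map_sub, map_one, sub_eq_zero]
    exact this
  rw [branchPoint_eq_zero_iff] at h2
  have hq𝔪 : q ≤ maximalIdeal R := IsLocalRing.le_maximalIdeal Ideal.IsPrime.ne_top'
  have h3 : r * y - 1 ∈ maximalIdeal R := hq𝔪 h2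
  have h4 : (1 : R) ∈ maximalIdeal R := by
    have := (maximalIdeal R).sub_mem (Ideal.mul_mem_right y _ hr) h3
    rwa [sub_sub_cancel] at this
  exact (maximalIdeal.isMaximal R).ne_top (Ideal.eq_top_of_isUnit_mem _ h4 isUnit_one)

end BranchRing

end Literature.AlgebraicGeometry.Resolution
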